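import Literature.Geometry.Manifold.LipschitzClarkeRegular
import HarnessLib

/-!
# Clarke's generalised Jacobian of a locally Lipschitz map: boundedness, compactness, locality,
# chain rules, upper semicontinuity, and uniform invertibility near a compact set of isomorphisms

Topic `Geometry/Manifold`; namespace `Literature.Geometry.Manifold`. First proof layer under the
named fact `Literature.Geometry.Manifold.KondoTanakaRecognition` (`LipschitzClarkeRegular.lean`,
Kondo–Tanaka 2017, Cor. 1.10): the elementary properties of the generalised Jacobian
`clarkeJacobian f x = conv {lim Df(uₖ) : uₖ → x}` (Clarke 1976, §1; Kondo–Tanaka 2017, (1.2) and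
§1.2) that the printed proof of Thm. 1.3 / Cor. 1.10 uses:

* `clarkeJacobianGen_subset_closedBall`, `clarkeJacobian_subset_closedBall` — for `f`
  `L`-Lipschitz near `x`, `∂f(x) ⊆ B̄(0, L)`;
* `isClosed_clarkeJacobianGen`, `isCompact_clarkeJacobian` — the generating set is closed, and in
  finite dimension `∂f(x)` is compact ("`∂F(x)` … are compact convex sets", K–T p. 4); this needs
  **Carathéodory**: the convex hull of a compact subset of a finite-dimensional space is compact
  (`isCompact_convexHull_of_isCompact`, not in Mathlib at this pin, which only has the finite case
  `Set.Finite.isCompact_convexHull`);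
* `clarkeJacobianGen_congr`, `clarkeJacobian_congr` — locality;
* `image_clarkeJacobian_comp_right_subset`, `image_clarkeJacobian_comp_left_subset` — the two
  chain-rule inclusions `∂g(τ u₀) ∘ Dτ(u₀) ⊆ ∂(g ∘ τ)(u₀)` for a local `C¹` homeomorphism `τ` and
  `DΦ(g x) ∘ ∂g(x) ⊆ ∂(Φ ∘ g)(x)` for a `C¹` map `Φ` (K–T §2.2: "the notion of the singular point
  of a Lipschitz map is independent of the choice of the Riemannian metric", and the transport of
  generalised differentials between charts);
* `eventually_fderiv_mem_thickening_clarkeJacobianGen` — **upper semicontinuity** (K–T Lemma 2.9: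
  for `η > 0` there is `δ > 0` with `Df(q) ∈ ∂f(p)_η` for a.e. `q ∈ B_δ(p)`);
* `exists_bound_below_of_isCompact` — near a compact set of injective linear maps of a
  finite-dimensional space, all maps of a closed `μ`-neighbourhood are uniformly bounded below
  (K–T Example 1.8 / Lemma 2.21: `⟨Au, v⟩ ≥ δ(p)` for all `A ∈ ∂F(q)`, `q` near `p`);
* `norm_sub_le_of_fderiv_mem` — **Clarke's increase estimate** (K–T Example 1.8, last display:
  "`‖F(q₂) − F(q₁)‖ ≥ δ(p) ‖q₂ − q₁‖`"): a `C¹` map on a convex set whose derivative stays in a closed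
  convex set of maps bounded below by `c` increases distances by the factor `c`; in particular it
  is injective there.

Everything here is proved; no definitions besides the statements' vocabulary from
`LipschitzClarkeRegular.lean`, no named facts.

## References

* F. H. Clarke, *On the inverse function theorem*, Pacific J. Math. 64 (1976) 97–102, §1, Lemmas
  1–3. [Clarke1976]
* K. Kondo, M. Tanaka, *Approximations of Lipschitz maps via immersions and differentiable exotic
  sphere theorems*, Nonlinear Anal. 155 (2017) 219–249 (arXiv:1408.6036), §1.2, Example 1.8,
  Lemmas 2.8, 2.9, 2.21. [KondoTanaka2017]
-/

noncomputable section

open scoped Topology NNReal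
open Set Function Filter Metric

namespace Literature.Geometry.Manifold

/-! ### Convex hulls of compact sets in finite dimension (Carathéodory) -/

section ConvexHull

variable {W : Type*} [NormedAddCommGroup W] [NormedSpace ℝ W] [FiniteDimensional ℝ W]

/-- Reindexing a finite sum along an embedding when the summand vanishes off its range.
[folklore] -/
private theorem sum_eq_sum_of_embedding {ι κ : Type*} [Fintype ι] [Fintype κ] {X : Type*}
    [AddCommMonoid X] (emb : ι ↪ κ) (g : κ → X) (hg : ∀ j, (¬ ∃ i, emb i = j) → g j = 0) :
    ∑ j, g j = ∑ i, g (emb i) := by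
  classical
  rw [← Finset.sum_map Finset.univ emb g]
  symm
  refine Finset.sum_subset (Finset.subset_univ _) fun j _ hj => hg j ?_
  rintro ⟨i, rfl⟩
  exact hj (Finset.mem_map_of_mem emb (Finset.mem_univ i))

/-- **Carathéodory: the convex hull of a compact subset of a finite-dimensional real normed space
is compact** — it is the continuous image of `Δ^d × s^{d+1}` (`d = dim W`) under
`(w, z) ↦ Σ wᵢ zᵢ`, by Carathéodory's theorem (Mathlib's `eq_pos_convex_span_of_mem_convexHull`)
padded to exactly `d + 1` points. [folklore] -/
theorem isCompact_convexHull_of_isCompact {s : Set W} (hs : IsCompact s) :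
    IsCompact (convexHull ℝ s) := by
  classical
  rcases s.eq_empty_or_nonempty with rfl | ⟨z₀, hz₀⟩
  · simp
  set m : ℕ := Module.finrank ℝ W + 1 with hm
  set Φ : (Fin m → ℝ) × (Fin m → W) → W := fun p => ∑ i, p.1 i • p.2 i with hΦ
  have hΦc : Continuous Φ := by
    refine continuous_finsetSum _ fun i _ => ?_
    exact ((continuous_apply i).comp continuous_fst).smul ((continuous_apply i).comp continuous_snd)
  set D : Set ((Fin m → ℝ) × (Fin m → W)) := stdSimplex ℝ (Fin m) ×ˢ Set.pi univ fun _ => s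
    with hD
  have hDc : IsCompact D := (isCompact_stdSimplex ℝ (Fin m)).prod (isCompact_univ_pi fun _ => hs)
  suffices heq : convexHull ℝ s = Φ '' D by rw [heq]; exact hDc.image hΦc
  refine Subset.antisymm (fun x hx => ?_) ?_
  · obtain ⟨ι, _, z, w, hzs, hai, hwpos, hw1, hwx⟩ := eq_pos_convex_span_of_mem_convexHull hx
    have hcard : Fintype.card ι ≤ Fintype.card (Fin m) := by
      rw [Fintype.card_fin, hm]
      exact hai.card_le_finrank_succ.trans (Nat.add_le_add_right (Submodule.finrank_le _) 1)
    obtain ⟨emb⟩ := Function.Embedding.nonempty_iff_card_le.2 hcard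
    have hoff_w : ∀ j, (¬ ∃ i, emb i = j) → Function.extend emb w 0 j = 0 := fun j hj => by
      rw [Function.extend_apply' _ _ _ hj]; rfl
    have hon_w : ∀ i, Function.extend emb w 0 (emb i) = w i := fun i =>
      emb.injective.extend_apply _ _ _
    have hon_z : ∀ i, Function.extend emb z (fun _ => z₀) (emb i) = z i := fun i =>
      emb.injective.extend_apply _ _ _
    refine ⟨(Function.extend emb w 0, Function.extend emb z fun _ => z₀), ⟨⟨fun j => ?_, ?_⟩, ?_⟩, ?_⟩
    · change 0 ≤ Function.extend emb w 0 j
      by_cases hj : ∃ i, emb i = j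
      · obtain ⟨i, rfl⟩ := hj
        rw [hon_w]; exact (hwpos i).le
      · rw [hoff_w j hj]
    · change ∑ j, Function.extend emb w 0 j = 1
      calc ∑ j, Function.extend emb w 0 j = ∑ i, Function.extend emb w 0 (emb i) :=
            sum_eq_sum_of_embedding emb _ hoff_w
        _ = ∑ i, w i := by simp only [hon_w]
        _ = 1 := hw1
    · refine Set.mem_univ_pi.2 fun j => ?_
      change Function.extend emb z (fun _ => z₀) j ∈ s
      by_cases hj : ∃ i, emb i = j
      · obtain ⟨i, rfl⟩ := hj
        rw [hon_z]; exact hzs ⟨i, rfl⟩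
      · rw [Function.extend_apply' _ _ _ hj]; exact hz₀
    · change ∑ j, Function.extend emb w 0 j • Function.extend emb z (fun _ => z₀) j = x
      calc ∑ j, Function.extend emb w 0 j • Function.extend emb z (fun _ => z₀) j
          = ∑ i, Function.extend emb w 0 (emb i) • Function.extend emb z (fun _ => z₀) (emb i) :=
            sum_eq_sum_of_embedding emb _ fun j hj => by rw [hoff_w j hj, zero_smul]
        _ = ∑ i, w i • z i := by simp only [hon_w, hon_z]
        _ = x := hwx
  · rintro _ ⟨⟨w, z⟩, ⟨hw, hz⟩, rfl⟩
    exact (convex_convexHull ℝ s).sum_mem (fun i _ => hw.1 i) hw.2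
      fun i _ => subset_convexHull ℝ s ((Set.mem_univ_pi.1 hz) i)

end ConvexHull

/-! ### Boundedness, closedness, compactness, locality -/

section Basic

variable {E : Type*} [NormedAddCommGroup E] [NormedSpace ℝ E]
  {F : Type*} [NormedAddCommGroup F] [NormedSpace ℝ F]
  {f g : E → F} {x : E}

/-- For `f` `L`-Lipschitz on a neighbourhood of `x`, every generator `lim Df(uₖ)` of `∂f(x)` has
norm `≤ L` (the tail of the sequence lies in the Lipschitz region, where `‖Df‖ ≤ L`).
[cite: Clarke1976, §1] -/
theorem clarkeJacobianGen_subset_closedBall {L : ℝ≥0} {s : Set E} (hs : s ∈ 𝓝 x)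
    (hf : LipschitzOnWith L f s) : clarkeJacobianGen f x ⊆ closedBall 0 L := by
  rintro A ⟨u, hu, -, hA⟩
  have h1 : ∀ᶠ k in atTop, fderiv ℝ f (u k) ∈ closedBall (0 : E →L[ℝ] F) L := by
    have h2 : ∀ᶠ y in 𝓝 x, s ∈ 𝓝 y := eventually_eventually_nhds.2 hs
    filter_upwards [hu.eventually h2] with k hk
    exact mem_closedBall_zero_iff.2 (norm_fderiv_le_of_lipschitzOn ℝ hk hf)
  exact isClosed_closedBall.mem_of_tendsto hA h1

/-- `∂f(x) ⊆ B̄(0, L)` for `f` `L`-Lipschitz near `x`. [cite: Clarke1976, §1] -/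
theorem clarkeJacobian_subset_closedBall {L : ℝ≥0} {s : Set E} (hs : s ∈ 𝓝 x)
    (hf : LipschitzOnWith L f s) : clarkeJacobian f x ⊆ closedBall 0 L :=
  convexHull_min (clarkeJacobianGen_subset_closedBall hs hf) (convex_closedBall _ _)

/-- Every element of `∂f(x)` has norm `≤ L` for `f` `L`-Lipschitz near `x`. [cite: Clarke1976, §1] -/
theorem norm_le_of_mem_clarkeJacobian {L : ℝ≥0} {s : Set E} (hs : s ∈ 𝓝 x)
    (hf : LipschitzOnWith L f s) {A : E →L[ℝ] F} (hA : A ∈ clarkeJacobian f x) : ‖A‖ ≤ L :=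
  mem_closedBall_zero_iff.1 (clarkeJacobian_subset_closedBall hs hf hA)

/-- The generating set of the generalised Jacobian is closed (a diagonal argument).
[folklore] -/
theorem isClosed_clarkeJacobianGen : IsClosed (clarkeJacobianGen f x) := by
  refine IsSeqClosed.isClosed fun A B hA hB => ?_
  have key : ∀ j : ℕ, ∃ y : E, dist y x < 1 / ((j : ℝ) + 1) ∧ DifferentiableAt ℝ f y ∧
      dist (fderiv ℝ f y) (A j) < 1 / ((j : ℝ) + 1) := by
    intro j
    obtain ⟨u, hu, hd, hlim⟩ := hA j
    have hpos : (0 : ℝ) < 1 / ((j : ℝ) + 1) := by positivity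
    obtain ⟨k, hk1, hk2⟩ := ((hu.eventually (ball_mem_nhds x hpos)).and
      (hlim.eventually (ball_mem_nhds (A j) hpos))).exists
    exact ⟨u k, hk1, hd k, hk2⟩
  choose y hy1 hy2 hy3 using key
  refine ⟨y, ?_, hy2, ?_⟩
  · rw [tendsto_iff_dist_tendsto_zero]
    exact squeeze_zero (fun j => dist_nonneg) (fun j => (hy1 j).le)
      tendsto_one_div_add_atTop_nhds_zero_nat
  · rw [tendsto_iff_dist_tendsto_zero]
    have h1 : Tendsto (fun j => dist (A j) B) atTop (𝓝 0) := tendsto_iff_dist_tendsto_zero.1 hB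
    refine squeeze_zero (fun j => dist_nonneg)
      (fun j => (dist_triangle _ (A j) _).trans (add_le_add (hy3 j).le le_rfl)) ?_
    simpa using tendsto_one_div_add_atTop_nhds_zero_nat.add h1

/-- In finite dimension, the generating set of `∂f(x)` of a map Lipschitz near `x` is compact.
[cite: KondoTanaka2017, §1.2] -/
theorem isCompact_clarkeJacobianGen [FiniteDimensional ℝ E] [FiniteDimensional ℝ F] {L : ℝ≥0}
    {s : Set E} (hs : s ∈ 𝓝 x) (hf : LipschitzOnWith L f s) :
    IsCompact (clarkeJacobianGen f x) :=
  (isCompact_closedBall (0 : E →L[ℝ] F) L).of_isClosed_subset isClosed_clarkeJacobianGen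
    (clarkeJacobianGen_subset_closedBall hs hf)

/-- **`∂f(x)` is compact** (finite dimension, `f` Lipschitz near `x`): "`∂F(x)`, `∂f(x)` are
compact convex sets". [cite: KondoTanaka2017, §1.2] -/
theorem isCompact_clarkeJacobian [FiniteDimensional ℝ E] [FiniteDimensional ℝ F] {L : ℝ≥0}
    {s : Set E} (hs : s ∈ 𝓝 x) (hf : LipschitzOnWith L f s) :
    IsCompact (clarkeJacobian f x) :=
  isCompact_convexHull_of_isCompact (isCompact_clarkeJacobianGen hs hf)

/-- Locality of the generating set: maps that agree near `x` have the same generators (shift the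
approximating sequence into the region of agreement). [folklore] -/
theorem clarkeJacobianGen_subset_of_eventuallyEq (hfg : f =ᶠ[𝓝 x] g) :
    clarkeJacobianGen f x ⊆ clarkeJacobianGen g x := by
  rintro A ⟨u, hu, hd, hA⟩
  obtain ⟨k₀, hk₀⟩ := eventually_atTop.1 (hu.eventually hfg.eventuallyEq_nhds)
  refine ⟨fun k => u (k + k₀), hu.comp (tendsto_add_atTop_nat k₀), fun k => ?_, ?_⟩
  · exact (hd (k + k₀)).congr_of_eventuallyEq (hk₀ (k + k₀) (Nat.le_add_left _ _)).symm
  · have heq : (fun k => fderiv ℝ g (u (k + k₀))) = fun k => fderiv ℝ f (u (k + k₀)) := by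
      funext k
      exact ((hk₀ (k + k₀) (Nat.le_add_left _ _)).symm).fderiv_eq
    rw [heq]
    exact hA.comp (tendsto_add_atTop_nat k₀)

/-- Locality of the generating set. [folklore] -/
theorem clarkeJacobianGen_congr (hfg : f =ᶠ[𝓝 x] g) :
    clarkeJacobianGen f x = clarkeJacobianGen g x :=
  Subset.antisymm (clarkeJacobianGen_subset_of_eventuallyEq hfg)
    (clarkeJacobianGen_subset_of_eventuallyEq hfg.symm)

/-- **Locality of the generalised Jacobian**: `∂f(x) = ∂g(x)` if `f = g` near `x`. [folklore] -/
theorem clarkeJacobian_congr (hfg : f =ᶠ[𝓝 x] g) : clarkeJacobian f x = clarkeJacobian g x := by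
  rw [clarkeJacobian, clarkeJacobian, clarkeJacobianGen_congr hfg]

/-- `ClarkeRegularAt` is local. [folklore] -/
theorem clarkeRegularAt_congr (hfg : f =ᶠ[𝓝 x] g) : ClarkeRegularAt f x ↔ ClarkeRegularAt g x := by
  rw [ClarkeRegularAt, ClarkeRegularAt, clarkeJacobian_congr hfg]

end Basic

/-! ### Chain rules -/

section ChainRule

variable {E : Type*} [NormedAddCommGroup E] [NormedSpace ℝ E]
  {E₂ : Type*} [NormedAddCommGroup E₂] [NormedSpace ℝ E₂]
  {F : Type*} [NormedAddCommGroup F] [NormedSpace ℝ F]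
  {G : Type*} [NormedAddCommGroup G] [NormedSpace ℝ G]

/-- Joint continuity of composition of continuous linear maps along a filter. [folklore] -/
private theorem tendsto_clm_comp {α : Type*} {l : Filter α} {g : α → F →L[ℝ] G}
    {f : α → E →L[ℝ] F} {g' : F →L[ℝ] G} {f' : E →L[ℝ] F} (hg : Tendsto g l (𝓝 g'))
    (hf : Tendsto f l (𝓝 f')) : Tendsto (fun k => (g k).comp (f k)) l (𝓝 (g'.comp f')) := by
  have hc : Continuous fun p : (F →L[ℝ] G) × (E →L[ℝ] F) => p.1.comp p.2 :=
    continuous_fst.clm_comp continuous_snd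
  exact (hc.tendsto (g', f')).comp (hg.prodMk_nhds hf)

/-- **Chain rule on the right, generators**: if `τ` is `C¹` near `u₀` with continuous derivative
`τ'` and admits a local right inverse `σ` at `τ u₀` (a local homeomorphism), then
`lim Dg(zₖ) ∘ Dτ(u₀)` is a generator of `∂(g ∘ τ)(u₀)` for every generator `lim Dg(zₖ)` of
`∂g(τ u₀)` (pull the sequence back by `σ`). [cite: KondoTanaka2017, §2.2] -/
theorem image_clarkeJacobianGen_comp_right_subset {g : E → F} {τ : E₂ → E} {σ : E → E₂} {u₀ : E₂}
    {τ' : E₂ → E₂ →L[ℝ] E} (hτ : ∀ᶠ u in 𝓝 u₀, HasFDerivAt τ (τ' u) u) (hτ' : ContinuousAt τ' u₀)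
    (hσ : ContinuousAt σ (τ u₀)) (hσu₀ : σ (τ u₀) = u₀) (hτσ : ∀ᶠ z in 𝓝 (τ u₀), τ (σ z) = z) :
    (fun A : E →L[ℝ] F => A.comp (τ' u₀)) '' clarkeJacobianGen g (τ u₀) ⊆
      clarkeJacobianGen (g ∘ τ) u₀ := by
  rintro _ ⟨A, ⟨z, hz, hd, hA⟩, rfl⟩
  -- the pulled-back sequence
  set w : ℕ → E₂ := fun k => σ (z k) with hw
  have hwt : Tendsto w atTop (𝓝 u₀) := by
    have h := hσ.tendsto.comp hz
    rwa [hσu₀] at h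
  obtain ⟨k₀, hk₀⟩ := eventually_atTop.1 ((hwt.eventually hτ).and (hz.eventually hτσ))
  refine ⟨fun k => w (k + k₀), hwt.comp (tendsto_add_atTop_nat k₀), fun k => ?_, ?_⟩
  · obtain ⟨h1, h2⟩ := hk₀ (k + k₀) (Nat.le_add_left _ _)
    have hg' : HasFDerivAt g (fderiv ℝ g (z (k + k₀))) (τ (w (k + k₀))) := by
      rw [show τ (w (k + k₀)) = z (k + k₀) from h2]; exact (hd _).hasFDerivAt
    exact (hg'.comp (w (k + k₀)) h1).differentiableAt
  · have heq : (fun k => fderiv ℝ (g ∘ τ) (w (k + k₀))) =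
        fun k => (fderiv ℝ g (z (k + k₀))).comp (τ' (w (k + k₀))) := by
      funext k
      obtain ⟨h1, h2⟩ := hk₀ (k + k₀) (Nat.le_add_left _ _)
      have hg' : HasFDerivAt g (fderiv ℝ g (z (k + k₀))) (τ (w (k + k₀))) := by
        rw [show τ (w (k + k₀)) = z (k + k₀) from h2]; exact (hd _).hasFDerivAt
      exact (hg'.comp (w (k + k₀)) h1).fderiv
    rw [heq]
    exact tendsto_clm_comp (hA.comp (tendsto_add_atTop_nat k₀))
      ((hτ'.tendsto.comp hwt).comp (tendsto_add_atTop_nat k₀))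

/-- **Chain rule on the right**: `∂g(τ u₀) ∘ Dτ(u₀) ⊆ ∂(g ∘ τ)(u₀)` for `τ` a local `C¹`
homeomorphism at `u₀` (the generalised differential read in another chart is the conjugate by the
derivative of the transition map). [cite: KondoTanaka2017, §2.2] -/
theorem image_clarkeJacobian_comp_right_subset {g : E → F} {τ : E₂ → E} {σ : E → E₂} {u₀ : E₂}
    {τ' : E₂ → E₂ →L[ℝ] E} (hτ : ∀ᶠ u in 𝓝 u₀, HasFDerivAt τ (τ' u) u) (hτ' : ContinuousAt τ' u₀)
    (hσ : ContinuousAt σ (τ u₀)) (hσu₀ : σ (τ u₀) = u₀) (hτσ : ∀ᶠ z in 𝓝 (τ u₀), τ (σ z) = z) :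
    (fun A : E →L[ℝ] F => A.comp (τ' u₀)) '' clarkeJacobian g (τ u₀) ⊆
      clarkeJacobian (g ∘ τ) u₀ := by
  have hlin : (fun A : E →L[ℝ] F => A.comp (τ' u₀)) =
      ((ContinuousLinearMap.compL ℝ E₂ E F).flip (τ' u₀)).toLinearMap := by
    funext A; rfl
  rw [clarkeJacobian, hlin, LinearMap.image_convexHull, ← hlin]
  exact convexHull_mono (image_clarkeJacobianGen_comp_right_subset hτ hτ' hσ hσu₀ hτσ)

/-- **Chain rule on the left, generators**: for `Φ` `C¹` near `g x` (continuous derivative `Φ'`)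
and `g` continuous at `x`, `DΦ(g x) ∘ lim Dg(uₖ)` is a generator of `∂(Φ ∘ g)(x)`.
[cite: KondoTanaka2017, §2.2] -/
theorem image_clarkeJacobianGen_comp_left_subset {g : E → F} {Φ : F → G} {x : E}
    {Φ' : F → F →L[ℝ] G} (hΦ : ∀ᶠ y in 𝓝 (g x), HasFDerivAt Φ (Φ' y) y)
    (hΦ' : ContinuousAt Φ' (g x)) (hg : ContinuousAt g x) :
    (fun A : E →L[ℝ] F => (Φ' (g x)).comp A) '' clarkeJacobianGen g x ⊆
      clarkeJacobianGen (Φ ∘ g) x := by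
  rintro _ ⟨A, ⟨u, hu, hd, hA⟩, rfl⟩
  have hgu : Tendsto (fun k => g (u k)) atTop (𝓝 (g x)) := hg.tendsto.comp hu
  obtain ⟨k₀, hk₀⟩ := eventually_atTop.1 (hgu.eventually hΦ)
  refine ⟨fun k => u (k + k₀), hu.comp (tendsto_add_atTop_nat k₀), fun k => ?_, ?_⟩
  · exact ((hk₀ (k + k₀) (Nat.le_add_left _ _)).comp (u (k + k₀))
      (hd (k + k₀)).hasFDerivAt).differentiableAt
  · have heq : (fun k => fderiv ℝ (Φ ∘ g) (u (k + k₀))) =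
        fun k => (Φ' (g (u (k + k₀)))).comp (fderiv ℝ g (u (k + k₀))) := by
      funext k
      exact ((hk₀ (k + k₀) (Nat.le_add_left _ _)).comp (u (k + k₀)) (hd (k + k₀)).hasFDerivAt).fderiv
    rw [heq]
    exact tendsto_clm_comp ((hΦ'.tendsto.comp hgu).comp (tendsto_add_atTop_nat k₀))
      (hA.comp (tendsto_add_atTop_nat k₀))

/-- **Chain rule on the left**: `DΦ(g x) ∘ ∂g(x) ⊆ ∂(Φ ∘ g)(x)` for `Φ` `C¹` near `g x` and `g`
continuous at `x`. [cite: KondoTanaka2017, §2.2] -/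
theorem image_clarkeJacobian_comp_left_subset {g : E → F} {Φ : F → G} {x : E}
    {Φ' : F → F →L[ℝ] G} (hΦ : ∀ᶠ y in 𝓝 (g x), HasFDerivAt Φ (Φ' y) y)
    (hΦ' : ContinuousAt Φ' (g x)) (hg : ContinuousAt g x) :
    (fun A : E →L[ℝ] F => (Φ' (g x)).comp A) '' clarkeJacobian g x ⊆ clarkeJacobian (Φ ∘ g) x := by
  have hlin : (fun A : E →L[ℝ] F => (Φ' (g x)).comp A) =
      (ContinuousLinearMap.compL ℝ E F G (Φ' (g x))).toLinearMap := by
    funext A; rfl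
  rw [clarkeJacobian, hlin, LinearMap.image_convexHull, ← hlin]
  exact convexHull_mono (image_clarkeJacobianGen_comp_left_subset hΦ hΦ' hg)

end ChainRule

/-! ### Upper semicontinuity (Kondo–Tanaka Lemma 2.9) -/

section USC

variable {E : Type*} [NormedAddCommGroup E] [NormedSpace ℝ E]
  {F : Type*} [NormedAddCommGroup F] [NormedSpace ℝ F]
  {f : E → F} {x : E}

/-- **Upper semicontinuity of the generalised Jacobian** (Kondo–Tanaka Lemma 2.9, chart form):
for `f` Lipschitz near `x` between finite-dimensional spaces and `η > 0`, at all points `z`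
near `x` where `f` is differentiable, `Df(z)` lies in the open `η`-neighbourhood of the
generating set of `∂f(x)` (by compactness of `B̄(0, L)`: otherwise a subsequence of the `Df(zₖ)`
converges to a generator at distance `≥ η` from the generators).
[cite: KondoTanaka2017, Lemma 2.9] -/
theorem eventually_fderiv_mem_thickening_clarkeJacobianGen [FiniteDimensional ℝ E]
    [FiniteDimensional ℝ F] {L : ℝ≥0} {s : Set E} (hs : s ∈ 𝓝 x) (hf : LipschitzOnWith L f s)
    {η : ℝ} (hη : 0 < η) :
    ∀ᶠ z in 𝓝 x, DifferentiableAt ℝ f z →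
      fderiv ℝ f z ∈ thickening η (clarkeJacobianGen f x) := by
  by_contra H
  obtain ⟨z, hz, hzP⟩ := exists_seq_forall_of_frequently (not_eventually.1 H)
  simp only [Classical.not_imp] at hzP
  -- shift into the Lipschitz region
  have h2 : ∀ᶠ y in 𝓝 x, s ∈ 𝓝 y := eventually_eventually_nhds.2 hs
  obtain ⟨k₀, hk₀⟩ := eventually_atTop.1 (hz.eventually h2)
  set z' : ℕ → E := fun k => z (k + k₀) with hz'
  have hz't : Tendsto z' atTop (𝓝 x) := hz.comp (tendsto_add_atTop_nat k₀)
  have hbd : ∀ k, fderiv ℝ f (z' k) ∈ closedBall (0 : E →L[ℝ] F) L := fun k =>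
    mem_closedBall_zero_iff.2
      (norm_fderiv_le_of_lipschitzOn ℝ (hk₀ (k + k₀) (Nat.le_add_left _ _)) hf)
  obtain ⟨A, -, φ, hφ, hAφ⟩ := (isCompact_closedBall (0 : E →L[ℝ] F) L).tendsto_subseq hbd
  -- the limit is a generator
  have hA : A ∈ clarkeJacobianGen f x :=
    ⟨z' ∘ φ, hz't.comp hφ.tendsto_atTop, fun k => (hzP (φ k + k₀)).1, hAφ⟩
  -- but every term is `η`-far from the generators
  have hfar : ∀ k, η ≤ dist (fderiv ℝ f (z' (φ k))) A := fun k => by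
    by_contra hlt
    exact (hzP (φ k + k₀)).2 (mem_thickening_iff.2 ⟨A, hA, lt_of_not_ge hlt⟩)
  have hlim : Tendsto (fun k => dist (fderiv ℝ f (z' (φ k))) A) atTop (𝓝 0) :=
    tendsto_iff_dist_tendsto_zero.1 hAφ
  have : η ≤ 0 := ge_of_tendsto' hlim hfar
  linarith

/-- Upper semicontinuity with respect to `∂f(x)` itself. [cite: KondoTanaka2017, Lemma 2.9] -/
theorem eventually_fderiv_mem_thickening_clarkeJacobian [FiniteDimensional ℝ E]
    [FiniteDimensional ℝ F] {L : ℝ≥0} {s : Set E} (hs : s ∈ 𝓝 x) (hf : LipschitzOnWith L f s)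
    {η : ℝ} (hη : 0 < η) :
    ∀ᶠ z in 𝓝 x, DifferentiableAt ℝ f z → fderiv ℝ f z ∈ thickening η (clarkeJacobian f x) := by
  filter_upwards [eventually_fderiv_mem_thickening_clarkeJacobianGen hs hf hη] with z hz hd
  exact thickening_subset_of_subset η clarkeJacobianGen_subset_clarkeJacobian (hz hd)

/-- **Non-emptiness** of `∂f(x)` for `f` Lipschitz near `x` between finite-dimensional spaces
(Rademacher: differentiability points accumulate at `x`; compactness of `B̄(0, L)` gives a
convergent subsequence of derivatives). [cite: KondoTanaka2017, §1.2] -/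
theorem clarkeJacobianGen_nonempty [FiniteDimensional ℝ E] [FiniteDimensional ℝ F]
    [MeasurableSpace E] [BorelSpace E] {L : ℝ≥0} {s : Set E} (hs : s ∈ 𝓝 x)
    (hf : LipschitzOnWith L f s) : (clarkeJacobianGen f x).Nonempty := by
  -- a Haar measure to run Rademacher
  let μ : MeasureTheory.Measure E := MeasureTheory.Measure.addHaar
  -- differentiability points are dense near `x`: pick a sequence of them converging to `x`
  have hfreq : ∃ᶠ z in 𝓝 x, DifferentiableAt ℝ f z := by
    rw [frequently_iff]
    intro U hU
    have hUs : U ∩ interior s ∈ 𝓝 x := inter_mem hU (interior_mem_nhds.2 hs)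
    have hpos : 0 < μ (U ∩ interior s) := MeasureTheory.Measure.measure_pos_of_mem_nhds μ hUs
    have hae : ∀ᵐ z ∂μ, z ∈ interior s → DifferentiableAt ℝ f z := by
      have h := (hf.mono interior_subset).ae_differentiableWithinAt_of_mem (μ := μ)
      filter_upwards [h] with z hz hzs
      exact (hz hzs).differentiableAt (isOpen_interior.mem_nhds hzs)
    by_contra hno
    push Not at hno
    have hzero : μ (U ∩ interior s) = 0 := by
      refine MeasureTheory.measure_eq_zero_iff_ae_notMem.2 ?_
      filter_upwards [hae] with z hz hzU
      exact hno z hzU.1 (hz hzU.2)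
    exact hpos.ne' hzero
  obtain ⟨z, hz, hzd⟩ := exists_seq_forall_of_frequently hfreq
  have h2 : ∀ᶠ y in 𝓝 x, s ∈ 𝓝 y := eventually_eventually_nhds.2 hs
  obtain ⟨k₀, hk₀⟩ := eventually_atTop.1 (hz.eventually h2)
  have hbd : ∀ k, fderiv ℝ f (z (k + k₀)) ∈ closedBall (0 : E →L[ℝ] F) L := fun k =>
    mem_closedBall_zero_iff.2
      (norm_fderiv_le_of_lipschitzOn ℝ (hk₀ (k + k₀) (Nat.le_add_left _ _)) hf)
  obtain ⟨A, -, φ, hφ, hAφ⟩ := (isCompact_closedBall (0 : E →L[ℝ] F) L).tendsto_subseq hbd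
  exact ⟨A, fun k => z (φ k + k₀), (hz.comp (tendsto_add_atTop_nat k₀)).comp hφ.tendsto_atTop,
    fun k => hzd _, hAφ⟩

end USC

/-! ### Uniform invertibility near a compact set of isomorphisms; Clarke's increase estimate -/

section BoundBelow

variable {E : Type*} [NormedAddCommGroup E] [NormedSpace ℝ E]
  {F : Type*} [NormedAddCommGroup F] [NormedSpace ℝ F]

/-- **Uniform lower bound near a compact set of injective maps** (finite-dimensional source):
if every `A` in a compact set `K ⊆ L(E, F)` is injective, there are `μ > 0` and `c > 0` with
`c ‖v‖ ≤ ‖A v‖` for all `A` in the closed `μ`-neighbourhood of `K` and all `v` (K–T Example 1.8 /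
Lemma 2.21: "`⟨Au, v⟩ ≥ 2δ(p)` for all `A ∈ ∂F(p)` … `≥ δ(p)` for all `A ∈ ∂F(q)`, `q` near
`p`"). [cite: KondoTanaka2017, Example 1.8] -/
theorem exists_bound_below_of_isCompact [FiniteDimensional ℝ E] {K : Set (E →L[ℝ] F)}
    (hK : IsCompact K) (hinj : ∀ A ∈ K, Injective A) :
    ∃ μ > (0 : ℝ), ∃ c > (0 : ℝ), ∀ A ∈ cthickening μ K, ∀ v : E, c * ‖v‖ ≤ ‖A v‖ := by
  -- pointwise lower bounds (finite dimension), locally uniform on balls, then a finite subcover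
  have hloc : ∀ A ∈ K, ∃ c > (0 : ℝ), ∃ ρ > (0 : ℝ), ∀ B ∈ ball A ρ, ∀ v : E, c * ‖v‖ ≤ ‖B v‖ := by
    intro A hA
    obtain ⟨k, hk, hanti⟩ := (A : E →ₗ[ℝ] F).exists_antilipschitzWith
      (LinearMap.ker_eq_bot.2 (hinj A hA))
    have hk0 : (0 : ℝ) < k := by exact_mod_cast hk
    refine ⟨(2 * k)⁻¹, by positivity, (2 * k)⁻¹, by positivity, fun B hB v => ?_⟩
    have h1 : ‖v‖ ≤ k * ‖A v‖ := by simpa using hanti.le_mul_dist v 0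
    have h2 : ‖A v - B v‖ ≤ (2 * (k : ℝ))⁻¹ * ‖v‖ := by
      change ‖(A - B) v‖ ≤ _
      refine (ContinuousLinearMap.le_opNorm _ _).trans (mul_le_mul_of_nonneg_right ?_ (norm_nonneg _))
      have : dist B A < (2 * (k : ℝ))⁻¹ := mem_ball.1 hB
      rw [dist_eq_norm, norm_sub_rev] at this
      exact this.le
    have h3 : ‖A v‖ ≤ ‖B v‖ + ‖A v - B v‖ := norm_le_insert' _ _
    have h4 : (k : ℝ)⁻¹ * ‖v‖ ≤ ‖A v‖ := by
      rw [inv_mul_le_iff₀ hk0]; exact h1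
    have h5 : (2 * (k : ℝ))⁻¹ * ‖v‖ = (k : ℝ)⁻¹ * ‖v‖ - (2 * (k : ℝ))⁻¹ * ‖v‖ := by ring
    linarith
  rcases K.eq_empty_or_nonempty with rfl | hKne
  · exact ⟨1, one_pos, 1, one_pos, fun A hA => by simp at hA⟩
  choose! c hc ρ hρ hcU using hloc
  obtain ⟨t, htK, hcover⟩ := hK.elim_nhds_subcover (fun A => ball A (ρ A))
    fun A hA => ball_mem_nhds A (hρ A hA)
  have htne : t.Nonempty := by
    by_contra h
    rw [Finset.not_nonempty_iff_eq_empty] at h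
    obtain ⟨A, hA⟩ := hKne
    simpa [h] using hcover hA
  have hopen : IsOpen (⋃ A ∈ t, ball A (ρ A)) := isOpen_biUnion fun A _ => isOpen_ball
  obtain ⟨μ, hμ, hμsub⟩ := hK.exists_cthickening_subset_open hopen hcover
  refine ⟨μ, hμ, t.inf' htne c, (Finset.lt_inf'_iff htne).2 fun A hA => hc A (htK A hA),
    fun A' hA' v => ?_⟩
  obtain ⟨A, hAt, hA'A⟩ := mem_iUnion₂.1 (hμsub hA')
  exact (mul_le_mul_of_nonneg_right (Finset.inf'_le c hAt) (norm_nonneg v)).trans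
    (hcU A (htK A hAt) A' hA'A v)

/-- A continuous linear endomorphism of a finite-dimensional space which is bounded below is
invertible. [folklore] -/
theorem isInvertible_of_bound_below [FiniteDimensional ℝ E] {A : E →L[ℝ] E} {c : ℝ} (hc : 0 < c)
    (hA : ∀ v, c * ‖v‖ ≤ ‖A v‖) : A.IsInvertible := by
  have hinj : Injective A := by
    intro v w hvw
    have h : c * ‖v - w‖ ≤ 0 := by simpa [map_sub, hvw] using hA (v - w)
    have h' : ‖v - w‖ ≤ 0 := by
      by_contra hlt
      exact absurd h (not_le.2 (mul_pos hc (lt_of_not_ge hlt)))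
    exact sub_eq_zero.1 (norm_le_zero_iff.1 h')
  let e : E ≃ₗ[ℝ] E := LinearEquiv.ofInjectiveEndo (A : E →ₗ[ℝ] E) hinj
  refine ⟨e.toContinuousLinearEquiv, ?_⟩
  ext v
  rfl

/-- **Clarke's increase estimate** (Clarke 1976, Lemma 3; Kondo–Tanaka Example 1.8: "if
`q₁, q₂ ∈ B̄_{r(p)}(p)`, … `‖F(q₂) − F(q₁)‖ ≥ δ(p) ‖q₂ − q₁‖`"), `C¹` form: if `f` is
differentiable on a convex set `U` with derivative `f'` continuous on `U` and valued in a compact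
convex set `𝒞` of linear maps all bounded below by `c`, then `c ‖b − a‖ ≤ ‖f b − f a‖` on `U` — the
averaged derivative `∫₀¹ f'(a + s(b − a)) ds` applied to `b − a` lies in the closed convex set
`𝒞 (b − a)`. [cite: KondoTanaka2017, Example 1.8] -/
theorem norm_sub_le_of_fderiv_mem [FiniteDimensional ℝ F] {f : E → F} {f' : E → E →L[ℝ] F}
    {U : Set E} (hU : Convex ℝ U) {𝒞 : Set (E →L[ℝ] F)} (h𝒞c : Convex ℝ 𝒞) (h𝒞k : IsCompact 𝒞)
    {c : ℝ} (hc : ∀ A ∈ 𝒞, ∀ v, c * ‖v‖ ≤ ‖A v‖) (hf : ∀ u ∈ U, HasFDerivAt f (f' u) u)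
    (hf'c : ContinuousOn f' U) (hmem : ∀ u ∈ U, f' u ∈ 𝒞) {a b : E} (ha : a ∈ U) (hb : b ∈ U) :
    c * ‖b - a‖ ≤ ‖f b - f a‖ := by
  set v : E := b - a with hv
  -- the segment and the chart along it
  set γ : ℝ → E := fun s => a + s • v with hγ
  have hγmem : ∀ s ∈ Icc (0 : ℝ) 1, γ s ∈ U := fun s hs => hU.add_smul_sub_mem ha hb hs
  have hγd : ∀ s, HasDerivAt γ v s := fun s => by
    have h := ((hasDerivAt_id' s).smul_const v).const_add a
    rw [one_smul] at h
    exact h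
  have hφd : ∀ s ∈ Icc (0 : ℝ) 1, HasDerivAt (f ∘ γ) (f' (γ s) v) s := fun s hs =>
    (hf _ (hγmem s hs)).comp_hasDerivAt s (hγd s)
  have hγc : Continuous γ := continuous_const.add (continuous_id.smul continuous_const)
  have hφ'c : ContinuousOn (fun s => f' (γ s) v) (Icc 0 1) :=
    ((hf'c.comp hγc.continuousOn hγmem).clm_apply continuousOn_const)
  -- fundamental theorem of calculus along the segment
  have hftc : ∫ s in (0 : ℝ)..1, f' (γ s) v = f b - f a := by
    have h := intervalIntegral.integral_eq_sub_of_hasDerivAt (a := (0 : ℝ)) (b := 1)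
      (f := f ∘ γ) (f' := fun s => f' (γ s) v)
      (fun s hs => hφd s (by simpa using hs)) (hφ'c.intervalIntegrable_of_Icc zero_le_one)
    simpa [hγ, hv] using h
  -- the averaged derivative applied to `v` lies in the compact convex set `𝒞 v`
  set 𝒞v : Set F := (fun A : E →L[ℝ] F => A v) '' 𝒞 with h𝒞v
  have h𝒞vc : Convex ℝ 𝒞v := h𝒞c.linear_image (ContinuousLinearMap.apply ℝ F v).toLinearMap
  have h𝒞vk : IsCompact 𝒞v := h𝒞k.image (ContinuousLinearMap.apply ℝ F v).continuous
  haveI : MeasureTheory.IsProbabilityMeasure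
      ((MeasureTheory.volume : MeasureTheory.Measure ℝ).restrict (Ioc 0 1)) :=
    ⟨by simp [Real.volume_Ioc]⟩
  have hmemv : (∫ s in (0 : ℝ)..1, f' (γ s) v) ∈ 𝒞v := by
    rw [intervalIntegral.integral_of_le zero_le_one]
    refine h𝒞vc.integral_mem h𝒞vk.isClosed ?_ ?_
    · refine MeasureTheory.ae_restrict_of_forall_mem measurableSet_Ioc fun s hs => ?_
      exact ⟨f' (γ s), hmem _ (hγmem s (Ioc_subset_Icc_self hs)), rfl⟩
    · exact (hφ'c.integrableOn_Icc.mono_set Ioc_subset_Icc_self)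
  obtain ⟨A, hA, hAv⟩ := hmemv
  rw [← hftc, ← hAv]
  exact hc A hA v

end BoundBelow

end Literature.Geometry.Manifold

end
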